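import Mathlib
import Literature.MathematicalPhysics.QuantumFieldTheory.Balaban1983to89.B5Bounds167Lattice
import Literature.MathematicalPhysics.QuantumFieldTheory.King1986.AveragingWeightRate

/-!
# The `η = L^{-k} → 0` RATE of Bałaban's `U = 1` effective gauge-field action `Δ_k` (B5 (1.66)) and of the
# vector averaging symbol (B5 (1.61)) — King's Prop. 3.10 / Lemma 4.4 SHAPE transferred to the Landau-gauge
# vector layer, kernel-checked, with the rate of the primitive alias sum `Δ₀φ_μ` as the ONE explicit hypothesis

Cell `pub-balaban`, T⁴-continuum fan-out, spine estimate NE2 (U1a) «η-rate of the linear theory», prover seat P2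
(unit `b2b-balaban-t4-ne2-p2`; technique: direct spectral / perturbation estimate in momentum space).  VALUE =
kernel-checked elementary analysis about PRINTED `U = 1` formulas; NOT summit progress (rung (B)+1 scoping on a
finite torus; no infinite volume, no mass gap, not the Clay problem).

## The printed objects (read as page images by this seat)

T. Bałaban, *Propagators and renormalization transformations for lattice gauge theories. I*, Commun. Math. Phys.
**95** (1984) 17–40 [cite: Balaban1984PropagatorsI] («B5»; renders `b2b-balaban-ref1/pages/1984-cmp95-propagators-
rt-I/…-p012-x2.png` = journal p. 28 and `…-p013-x2.png` = p. 29; PDF page = journal page − 16):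

p. 28, (1.61): «(Q_kA)~_μ(p′) = Σ_l u(p′+l) v_μ(p′+l) Ã_μ(p′+l),  v_μ(p) = ∂¹_μ(p′)/∂_μ(p)»;
(1.62): «φ_μ(p′) = Σ_l |u(p′+l)|² |v_μ(p′+l)|² / Δ(p′+l), where we have omitted the subscript k. Multiplying
φ_μ(p′) by Δ₀(p′), we get a well-defined positive function for all p′ ∈ T̃₁^{(k)}, 0 < γ₀ ≤ Δ₀(p′)φ_μ(p′) ≤ γ₁.»
p. 29, (1.65)–(1.67): «The action Δ_k is thus defined by ⟨B, Δ_kB⟩ = ⟨∂H_kB, ∂H_kB⟩. (1.65) Using formulas (1.60)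
or (1.63) we obtain the following expression
  ⟨B, Δ_kB⟩ = … = ⟨∂₁B, σ_k∂₁B⟩
            = ½ Σ_{μ,ν} (2π)^{−d} ∫dp′ [ (Σ_{λ=1}^{d} |∂¹_λ(p′)|²/(Δ₀²(p′)φ_λ(p′))) Δ₀(p′)φ_μ(p′)Δ₀(p′)φ_ν(p′) ]⁻¹
              |(∂₁B)~_{μν}(p′)|².   (1.66)
The function under the integral is bounded from below and above by positive constants γ₀, γ₁ dependent on d
only, so we have  γ₀⟨∂₁B, ∂₁B⟩ ≤ ⟨B, Δ_kB⟩ ≤ γ₁⟨∂₁B, ∂₁B⟩. (1.67)»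

Bałaban prints these bounds UNIFORMLY in `k` (in `η = L^{−k}`) and prints NO rate of convergence as `η → 0` for
`Δ_k` (cell file `t4/T4-XREAD-U1a.md` X8: «no printed rate anywhere»).  The printed and proved RATE statements of
this kind are King's, for the SCALAR block-averaging effective Laplacian at zero background:

C. King, *The U(1) Higgs model. I. The continuum limit*, Commun. Math. Phys. **102** (1986) 649–677 [cite:
King1986] (TEMPLATE literature of the cell, not a manuscript under audit; renders `b2b-balaban-template/king-
renders/1986-cmp102-king-u1-higgs-I-p021-x2.png` = p. 669, `…-p025-x2.png` = p. 673, read as images by this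
seat), p. 669: «**Proposition 3.10.** |Δ^{(k)}(p)| ≤ C uniformly in k,  |Δ^{(k)}(p) − Δ^{(k+n)}(p)| ≤ CL^{−2k}
|Δ^{(k)}(p)|. (3.91)  From Proposition 3.10 we get immediately  |⟨A_k, (Δ^{(k)} − Δ^{(k+n)})A_k⟩| ≤ CL^{−2k}
(p(L^kε))²(μ₀L^kε)^{−2}(L^kε)^{−d}|T|, (3.92) where we used the bounds (3.2).»; p. 673: «**Lemma 4.4.**
|u_k^η(p′+l) − u_{k+n}^{η′}(p′+l)| ≤ CL^{−γk}|p′+l|^γ|u_k^η(p′+l)|. (4.29)» with its proof (4.30) «By repeated use of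
the identity xy − zw = 1/2(x − y)(z + w) + 1/2(x + y)(z − w) … Each term is a product of d factors, at least one of
which is the left-hand side of (4.25).» (kernel: `King1986.CompositionLaw.lemma43`, `King1986.AveragingWeightRate.
lemma44`).  King's (3.92) closes the form difference with the a-priori field bounds (3.2); the analogue below closes
it with `⟨∂₁B, ∂₁B⟩`, resp. `⟨B, Δ_kB⟩` through (1.67).

## What this module PROVES (kernel, 0 sorry; every theorem is [folklore]/[analysis] arithmetic about the typed
## printed formulas of `B5Bounds167Lattice`; NO `def … : Prop`, no named fact introduced)

All symbols are the tree's: `phi162 n μ s` = (1.62) at reduced momentum `p′ = s`, `n = L^k = η⁻¹` fine points per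
unit block side; `Delta1r 0 s = Δ₀(p′)`; `w166 n μ ν s` = the function under the integral in (1.66); `formDk n M B`
= `⟨B, Δ_kB⟩` on the unit torus `T₁ = Π_μ ℤ/M_μ` AS GIVEN BY (1.66); `d1Sq M B = ⟨∂₁B, ∂₁B⟩`; the explicit
constants `γ₀ = (4/π²)^{d+2}`, `γ₁ = 1` of `B5Bounds167Lattice.Delta0_phi162_bounds` (d only; the paper prints none).
* §1 `sig a x μ ν := [(Σ_λ a_λ/x_λ)·x_μ·x_ν]⁻¹` and `w166_eq_sig`: the (1.66) weight IS `sig` evaluated at the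
  `k`-INDEPENDENT convex weights `a_λ(p′) = |∂¹_λ(p′)|²/Δ₀(p′)` (`Σ_λ a_λ = 1`) and the `d` inputs
  `x_λ = Δ₀(p′)φ^{(k)}_λ(p′)` — so ALL the `k`-dependence of `Δ_k`'s multiplier sits in the `d` scalars `Δ₀φ_λ`.
* §2 [folklore] on the box `[γ, 1]^d` (`0 < γ ≤ 1`): `γ ≤ sig ≤ γ⁻²` and the LIPSCHITZ bound
  `|sig a x − sig a x′| ≤ 3γ⁻⁶ · δ` whenever `|x_λ − x′_λ| ≤ δ` for all `λ` (`sig_lipschitz`); the two inverse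
  `p′`-factors of (1.63)/(1.83)–(1.84), `1/x_μ` and `(Σ_λ a_λ/x_λ)⁻¹`, are Lipschitz with constant `γ⁻²`
  (`inv_lipschitz_on_box`, `invMean_lipschitz`).
* §3 **the rate of `Δ_k`'s multiplier from the rate of `Δ₀φ`** (`w166_rate_of_phi162_rate`): for ANY two block
  sizes `n, n′ ≥ 1`, on the punctured Brillouin zone, if `|Δ₀(p′)φ^{(n)}_λ(p′) − Δ₀(p′)φ^{(n′)}_λ(p′)| ≤ θ` for all
  `λ`, then `|w166 n μ ν p′ − w166 n′ μ ν p′| ≤ 3γ₀⁻⁶·θ`, and the RELATIVE form `≤ 3γ₀⁻⁷·θ·w166 n μ ν p′`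
  (`w166_rate_rel`) — King's (3.91) shape for Bałaban's `Δ_k`.
* §4 **form level** (`formDk_rate_of_phi162_rate`, `formDk_rate_rel`): on every unit torus and for every vector
  field `B`, `|⟨B, Δ^{(n)}B⟩ − ⟨B, Δ^{(n′)}B⟩| ≤ 3γ₀⁻⁶θ·⟨∂₁B, ∂₁B⟩ ≤ 3γ₀⁻⁷θ·⟨B, Δ^{(n)}B⟩` — King's (3.92) shape.
  With `θ = C·L^{−2k}` (the shape King proves for the scalar alias sum, Lemma 4.3, and the shape the sibling seat
  P1's composition-law leaf is to prove for `Δ₀φ_μ`) this is `|⟨B,(Δ_k − Δ_{k+n})B⟩| ≤ C′L^{−2k}⟨B,Δ_kB⟩`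
  (`formDk_rate_king_shape`, a specialisation; the `L^{−2k}`-hypothesis is DISPLAYED there, not asserted) — the
  (3.91)/(3.92)-type statement for Bałaban's `U = 1` gauge-field action that `t4/T4-XREAD-U1a.md` X8 records as
  printed nowhere, REDUCED to the rate of the `d` primitive alias sums with nothing else assumed.
* §5 **Lemma 4.4 for the VECTOR averaging symbol** (`lemma44_vector`): in King's (4.3) vocabulary
  (`King1986.uFac`, `uWeight`) the symbol of (1.61) is, up to complex conjugation (B5 writes `e^{+ip}`, King
  `e^{−ip}`; same modulus, same rate), `u(p)·v_μ(p) = (Π_ν f_η(p_ν))·f_η(p_μ)` — a product of `d + 1` factors of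
  the kind (4.25) bounds — hence `‖(uv_μ)^η(p) − (uv_μ)^{η′}(p)‖ ≤ (π/2)^{d+1}((π/2)|η − η′|(Σ_ν|p_ν| + |p_μ|))
  ‖(uv_μ)^η(p)‖` on the common zone (`γ = 1`, explicit constant), by the tree's `norm_prod_sub_prod_le_rel`.
* §6 (v1.1) **corollaries GIVEN `hφ`**: `hphi_of_phi162_rate` (the sibling's announced shape `|φ^{(n)} − φ^{(n′)}|
  ≤ θ′` gives `hφ` with `θ = 4dθ′`); `log_w166_rate` (per-mode log-rate `≤ 3γ₀⁻⁷θ`, King's (3.93) ingredient);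
  `exists_limit_of_uniform_tail` ([folklore] uniformly small tails ⇒ limit with the same rate) and its instances
  `w166_limit` (the multiplier of `Δ_k` at fixed `p′ ≠ 0` CONVERGES as `k → ∞` with `|w166 (L^k) − w_∞| ≤
  3γ₀⁻⁶C_φL^{−2k}`, `w_∞ ≥ γ₀`) and `formDk_limit` (`|⟨B,Δ_kB⟩ − F_∞(B)| ≤ 3γ₀⁻⁶C_φL^{−2k}⟨∂₁B,∂₁B⟩` for every `B`
  on every unit torus) — the unit-scale `η → 0` limit of the `U = 1` effective gauge-field action WITH ITS RATE,
  conditional on `hφ` in King's Lemma 4.3 shape and on nothing else.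
* §7 (v1.2) **the second primitive alias sum of (1.63)**, `psi163 n s = Σ_{l″}|u(p′+l″)|²Δ₀²(p′)/Δ²(p′+l″)`
  (typed here; the normalising sum of the second term of `H_kB`'s momentum representation, p. 28): KERNEL
  two-sided bounds `γ₀ ≤ ψ₂ ≤ 1` on the punctured Brillouin zone for every `n ≥ 1` (`psi163_lower`,
  `psi163_le_one`, from the tree's `Ur_zero_ge`, `DeltaXir_le_Delta1r`, `Delta1r_le_DeltaXir_shift`,
  `sum_Ur_eq_one`), and `inv_psi163_rate`: GIVEN a rate `hψ` on `ψ₂` (NOT proved here, cell GAPS G-ne2p2-2)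
  the inverse factor moves by `≤ γ₀⁻²θ_ψ` — so every inverse `p′`-factor of (1.63) is now covered by §3 + §7.

## HONEST SCOPE — what is NOT proved here
(a) The hypothesis `hφ` (the rate of the primitive alias sums `Δ₀φ_μ`) is NOT proved in this file: it is the
sibling seat P1's deliverable (journal CLAIM l.46170, King's composition law (4.12) transferred to (1.62)); here it
is an explicit hypothesis of every rate theorem, never a cited fact.  (b) `formDk` is `⟨B,Δ_kB⟩` AS GIVEN BY the
third expression of (1.66); the identification with the definition (1.64)–(1.65) is B5's derivation pp. 27–29,
whose fibre algebra is kernel-checked in `B5Action165Lagrange` §2–§3 modulo the instantiation recorded there — not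
touched here.  (c) Nothing about `U ≠ 1` (background fields, B6 (2.129)–(2.132), B9), about the `T_η`-kernels
`H_k` (1.63) / `G` (1.83) beyond the factor lemmas of §2/§5, about position-space rates (King Props. 3.8–3.9), or
about `d = 4` specifically (everything holds for every `d`).
-/

noncomputable section

namespace Literature.MathematicalPhysics.QuantumFieldTheory.Balaban1983to89.T4GaugeActionRate

open scoped BigOperators
open Finset
open Literature.MathematicalPhysics.QuantumFieldTheory.Balaban1983to89.B4Strip
open Literature.MathematicalPhysics.QuantumFieldTheory.Balaban1983to89.B5Prop11Leaves
open Literature.MathematicalPhysics.QuantumFieldTheory.Balaban1983to89.B5Prop11Fiber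
open Literature.MathematicalPhysics.QuantumFieldTheory.Balaban1983to89.B5Prop11Plancherel
open Literature.MathematicalPhysics.QuantumFieldTheory.Balaban1983to89.B5Bounds167Lattice

variable {d : ℕ}

/-! ## §1. The (1.66) weight as a rational function of the `d` scalars `x_λ = Δ₀φ_λ` -/

section Sig

/-- `σ(a; x)_{μν} = [(Σ_λ a_λ/x_λ)·x_μ·x_ν]⁻¹` — the function under the integral of (1.66) written in the
variables `a_λ = |∂¹_λ(p′)|²/Δ₀(p′)` (weights) and `x_λ = Δ₀(p′)φ_λ(p′)` (inputs). [folklore] -/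
def sig (a x : Fin d → ℝ) (μ ν : Fin d) : ℝ := 1 / ((∑ κ, a κ / x κ) * x μ * x ν)

/-- the weights `a_λ(p′) = |∂¹_λ(p′)|²/Δ₀(p′) = S₁(p′_λ)/Δ₀(p′)`. [folklore] -/
def aW (s : Fin d → ℝ) (κ : Fin d) : ℝ := S1r (s κ) / Delta1r 0 s

/-- the inputs `x_λ = Δ₀(p′)φ^{(n)}_λ(p′)`. [cite: Balaban1984PropagatorsI, (1.62) p.28] -/
def xIn (n : ℕ) (s : Fin d → ℝ) (κ : Fin d) : ℝ := Delta1r 0 s * phi162 n κ s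

/-- **(1.66) = `σ(a; x)`**: `w166 n μ ν s = sig (aW s) (xIn n s) μ ν` — an unconditional algebraic identity
(`|∂¹_λ|²/(Δ₀²φ_λ) = (S₁/Δ₀)/(Δ₀φ_λ)`). [cite: Balaban1984PropagatorsI, (1.66) p.29] -/
theorem w166_eq_sig (n : ℕ) (μ ν : Fin d) (s : Fin d → ℝ) :
    w166 n μ ν s = sig (aW s) (xIn n s) μ ν := by
  unfold w166 sig aW xIn
  congr 1
  congr 1
  congr 1
  refine Finset.sum_congr rfl fun κ _ => ?_
  rw [norm_d1Sym_sq, div_div]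
  congr 1
  ring

/-- the weights are nonnegative. [folklore] -/
theorem aW_nonneg (s : Fin d → ℝ) (κ : Fin d) : 0 ≤ aW s κ :=
  div_nonneg (S1r_nonneg _) (Delta1r_nonneg 0 le_rfl s)

/-- the weights sum to one off `Δ₀(p′) = 0` (`Δ₀ = Σ_λ S₁(p′_λ)`). [folklore] -/
theorem sum_aW_eq_one (s : Fin d → ℝ) (hΔ : Delta1r 0 s ≠ 0) : ∑ κ, aW s κ = 1 := by
  unfold aW
  rw [← Finset.sum_div]
  have : ∑ κ : Fin d, S1r (s κ) = Delta1r 0 s := by unfold Delta1r; simp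
  rw [this, div_self hΔ]

end Sig

/-! ## §2. Bounds and Lipschitz estimates on the box `[γ, 1]^d` -/

section Lipschitz

variable (a x x' : Fin d → ℝ) (γ δ : ℝ)

/-- the weighted harmonic-type mean `T(x) = Σ_λ a_λ/x_λ` lies in `[1, γ⁻¹]` on the box. [folklore] -/
theorem mean_bounds (hγ : 0 < γ) (ha : ∀ κ, 0 ≤ a κ) (ha1 : ∑ κ, a κ = 1)
    (hx : ∀ κ, γ ≤ x κ ∧ x κ ≤ 1) :
    1 ≤ ∑ κ, a κ / x κ ∧ ∑ κ, a κ / x κ ≤ 1 / γ := by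
  constructor
  · calc (1 : ℝ) = ∑ κ, a κ * 1 := by rw [← Finset.sum_mul, ha1, one_mul]
      _ ≤ ∑ κ, a κ / x κ := by
          refine Finset.sum_le_sum fun κ _ => ?_
          have hxpos : 0 < x κ := lt_of_lt_of_le hγ (hx κ).1
          rw [div_eq_mul_one_div]
          refine mul_le_mul_of_nonneg_left ?_ (ha κ)
          rw [le_div_iff₀ hxpos, one_mul]
          exact (hx κ).2
  · calc ∑ κ, a κ / x κ ≤ ∑ κ, a κ * (1 / γ) := by
          refine Finset.sum_le_sum fun κ _ => ?_
          have hxpos : 0 < x κ := lt_of_lt_of_le hγ (hx κ).1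
          rw [div_eq_mul_one_div]
          exact mul_le_mul_of_nonneg_left (one_div_le_one_div_of_le hγ (hx κ).1) (ha κ)
      _ = 1 / γ := by rw [← Finset.sum_mul, ha1, one_mul]

/-- `|1/y − 1/y′| ≤ γ⁻²|y − y′|` for `y, y′ ≥ γ > 0`. [folklore] -/
theorem abs_inv_sub_inv_le {y y' : ℝ} (hγ : 0 < γ) (hy : γ ≤ y) (hy' : γ ≤ y') :
    |1 / y - 1 / y'| ≤ 1 / γ ^ 2 * |y - y'| := by
  have hypos : 0 < y := lt_of_lt_of_le hγ hy
  have hy'pos : 0 < y' := lt_of_lt_of_le hγ hy'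
  have hrw : 1 / y - 1 / y' = (y' - y) / (y * y') := by
    field_simp
  rw [hrw, abs_div, abs_of_pos (mul_pos hypos hy'pos), abs_sub_comm, div_eq_mul_one_div, mul_comm]
  refine mul_le_mul_of_nonneg_right ?_ (abs_nonneg _)
  refine one_div_le_one_div_of_le (by positivity) ?_
  rw [sq]
  exact mul_le_mul hy hy' hγ.le hypos.le

/-- **the inverse factor `1/(Δ₀φ_μ)` of (1.63)/(1.83)**: Lipschitz with constant `γ⁻²` on the box.
[folklore] -/
theorem inv_lipschitz_on_box (hγ : 0 < γ) (hx : ∀ κ, γ ≤ x κ ∧ x κ ≤ 1)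
    (hx' : ∀ κ, γ ≤ x' κ ∧ x' κ ≤ 1) (hδ : ∀ κ, |x κ - x' κ| ≤ δ) (μ : Fin d) :
    |1 / x μ - 1 / x' μ| ≤ 1 / γ ^ 2 * δ :=
  le_trans (abs_inv_sub_inv_le γ hγ (hx μ).1 (hx' μ).1)
    (mul_le_mul_of_nonneg_left (hδ μ) (by positivity))

/-- the mean moves by at most `γ⁻²δ`: `|T(x) − T(x′)| ≤ γ⁻²δ`. [folklore] -/
theorem abs_mean_sub_mean_le (hγ : 0 < γ) (ha : ∀ κ, 0 ≤ a κ) (ha1 : ∑ κ, a κ = 1)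
    (hx : ∀ κ, γ ≤ x κ ∧ x κ ≤ 1) (hx' : ∀ κ, γ ≤ x' κ ∧ x' κ ≤ 1) (hδ : ∀ κ, |x κ - x' κ| ≤ δ) :
    |∑ κ, a κ / x κ - ∑ κ, a κ / x' κ| ≤ 1 / γ ^ 2 * δ := by
  rw [← Finset.sum_sub_distrib]
  calc |∑ κ, (a κ / x κ - a κ / x' κ)| ≤ ∑ κ, |a κ / x κ - a κ / x' κ| := Finset.abs_sum_le_sum_abs _ _
    _ ≤ ∑ κ, a κ * (1 / γ ^ 2 * δ) := by
        refine Finset.sum_le_sum fun κ _ => ?_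
        have h1 : a κ / x κ - a κ / x' κ = a κ * (1 / x κ - 1 / x' κ) := by ring
        rw [h1, abs_mul, abs_of_nonneg (ha κ)]
        exact mul_le_mul_of_nonneg_left (inv_lipschitz_on_box x x' γ δ hγ hx hx' hδ κ) (ha κ)
    _ = 1 / γ ^ 2 * δ := by rw [← Finset.sum_mul, ha1, one_mul]

/-- **the inverse mean `(Σ_λ a_λ/x_λ)⁻¹`** (the normalised `p′`-factor `N(p′)⁻¹` of (1.63)/(1.83), up to the
`k`-independent `Δ₀`): Lipschitz with constant `γ⁻²` on the box (`T, T′ ≥ 1`). [folklore] -/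
theorem invMean_lipschitz (hγ : 0 < γ) (ha : ∀ κ, 0 ≤ a κ) (ha1 : ∑ κ, a κ = 1)
    (hx : ∀ κ, γ ≤ x κ ∧ x κ ≤ 1) (hx' : ∀ κ, γ ≤ x' κ ∧ x' κ ≤ 1) (hδ : ∀ κ, |x κ - x' κ| ≤ δ) :
    |1 / (∑ κ, a κ / x κ) - 1 / (∑ κ, a κ / x' κ)| ≤ 1 / γ ^ 2 * δ := by
  have hT := (mean_bounds a x γ hγ ha ha1 hx).1
  have hT' := (mean_bounds a x' γ hγ ha ha1 hx').1
  calc |1 / (∑ κ, a κ / x κ) - 1 / (∑ κ, a κ / x' κ)|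
      ≤ 1 / (1 : ℝ) ^ 2 * |∑ κ, a κ / x κ - ∑ κ, a κ / x' κ| := abs_inv_sub_inv_le 1 one_pos hT hT'
    _ = |∑ κ, a κ / x κ - ∑ κ, a κ / x' κ| := by norm_num
    _ ≤ 1 / γ ^ 2 * δ := abs_mean_sub_mean_le a x x' γ δ hγ ha ha1 hx hx' hδ

/-- two-sided bound `γ ≤ σ(a;x) ≤ γ⁻²` on the box (the content of «bounded from below and above by positive
constants», in the variables of §1). [folklore] -/
theorem sig_bounds (hγ : 0 < γ) (ha : ∀ κ, 0 ≤ a κ) (ha1 : ∑ κ, a κ = 1)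
    (hx : ∀ κ, γ ≤ x κ ∧ x κ ≤ 1) (μ ν : Fin d) :
    γ ≤ sig a x μ ν ∧ sig a x μ ν ≤ 1 / γ ^ 2 := by
  obtain ⟨hT1, hTγ⟩ := mean_bounds a x γ hγ ha ha1 hx
  have hxμ := hx μ
  have hxν := hx ν
  have hμpos : 0 < x μ := lt_of_lt_of_le hγ hxμ.1
  have hνpos : 0 < x ν := lt_of_lt_of_le hγ hxν.1
  have hTpos : 0 < ∑ κ, a κ / x κ := lt_of_lt_of_le one_pos hT1
  have hDlo : γ ^ 2 ≤ (∑ κ, a κ / x κ) * x μ * x ν := by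
    calc γ ^ 2 = 1 * γ * γ := by ring
      _ ≤ (∑ κ, a κ / x κ) * x μ * x ν := by
          refine mul_le_mul (mul_le_mul hT1 hxμ.1 hγ.le hTpos.le) hxν.1 hγ.le ?_
          exact mul_nonneg hTpos.le hμpos.le
  have hDhi : (∑ κ, a κ / x κ) * x μ * x ν ≤ 1 / γ := by
    calc (∑ κ, a κ / x κ) * x μ * x ν ≤ (1 / γ) * 1 * 1 := by
          refine mul_le_mul (mul_le_mul hTγ hxμ.2 hμpos.le (by positivity)) hxν.2 hνpos.le (by positivity)
      _ = 1 / γ := by ring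
  have hDpos : 0 < (∑ κ, a κ / x κ) * x μ * x ν := lt_of_lt_of_le (by positivity) hDlo
  unfold sig
  constructor
  · calc γ = 1 / (1 / γ) := by rw [one_div_one_div]
      _ ≤ 1 / ((∑ κ, a κ / x κ) * x μ * x ν) := one_div_le_one_div_of_le hDpos hDhi
  · exact one_div_le_one_div_of_le (by positivity) hDlo

/-- **`σ` is uniformly Lipschitz on the box**: `|σ(a;x) − σ(a;x′)| ≤ 3γ⁻⁶·δ` whenever `0 < γ ≤ 1`,
`x, x′ ∈ [γ,1]^d` and `|x_λ − x′_λ| ≤ δ` for all `λ`.  (`D = T x_μ x_ν ≥ γ²`; `|D − D′| ≤ |T − T′| + T′·|x_μx_ν −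
x′_μx′_ν| ≤ γ⁻²δ + γ⁻¹·2δ ≤ 3γ⁻²δ`; `|1/D − 1/D′| ≤ |D − D′|/(DD′)`.) [folklore] -/
theorem sig_lipschitz (hγ : 0 < γ) (hγ1 : γ ≤ 1) (ha : ∀ κ, 0 ≤ a κ) (ha1 : ∑ κ, a κ = 1)
    (hx : ∀ κ, γ ≤ x κ ∧ x κ ≤ 1) (hx' : ∀ κ, γ ≤ x' κ ∧ x' κ ≤ 1) (hδ : ∀ κ, |x κ - x' κ| ≤ δ)
    (μ ν : Fin d) :
    |sig a x μ ν - sig a x' μ ν| ≤ 3 / γ ^ 6 * δ := by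
  obtain ⟨hT1, hTγ⟩ := mean_bounds a x γ hγ ha ha1 hx
  obtain ⟨hT1', hTγ'⟩ := mean_bounds a x' γ hγ ha ha1 hx'
  set T : ℝ := ∑ κ, a κ / x κ with hT
  set T' : ℝ := ∑ κ, a κ / x' κ with hT'
  have hδ0 : 0 ≤ δ := le_trans (abs_nonneg _) (hδ μ)
  have hxμ := hx μ
  have hxν := hx ν
  have hxμ' := hx' μ
  have hxν' := hx' ν
  have hTpos : 0 < T := lt_of_lt_of_le one_pos hT1
  have hT'pos : 0 < T' := lt_of_lt_of_le one_pos hT1'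
  -- the denominators
  set D : ℝ := T * x μ * x ν with hD
  set D' : ℝ := T' * x' μ * x' ν with hD'
  have hDlo : γ ^ 2 ≤ D := by
    calc γ ^ 2 = 1 * γ * γ := by ring
      _ ≤ T * x μ * x ν := by
          refine mul_le_mul (mul_le_mul hT1 hxμ.1 hγ.le hTpos.le) hxν.1 hγ.le ?_
          exact mul_nonneg hTpos.le (le_trans hγ.le hxμ.1)
  have hDlo' : γ ^ 2 ≤ D' := by
    calc γ ^ 2 = 1 * γ * γ := by ring
      _ ≤ T' * x' μ * x' ν := by
          refine mul_le_mul (mul_le_mul hT1' hxμ'.1 hγ.le hT'pos.le) hxν'.1 hγ.le ?_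
          exact mul_nonneg hT'pos.le (le_trans hγ.le hxμ'.1)
  have hγ2 : 0 < γ ^ 2 := by positivity
  have hDpos : 0 < D := lt_of_lt_of_le hγ2 hDlo
  have hD'pos : 0 < D' := lt_of_lt_of_le hγ2 hDlo'
  -- |T - T'| ≤ δ/γ²
  have hTT : |T - T'| ≤ 1 / γ ^ 2 * δ := abs_mean_sub_mean_le a x x' γ δ hγ ha ha1 hx hx' hδ
  -- |x_μ x_ν - x'_μ x'_ν| ≤ 2δ
  have hxx : |x μ * x ν - x' μ * x' ν| ≤ 2 * δ := by
    have h1 : x μ * x ν - x' μ * x' ν = (x μ - x' μ) * x ν + x' μ * (x ν - x' ν) := by ring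
    rw [h1]
    calc |(x μ - x' μ) * x ν + x' μ * (x ν - x' ν)|
        ≤ |(x μ - x' μ) * x ν| + |x' μ * (x ν - x' ν)| := abs_add_le _ _
      _ = |x μ - x' μ| * x ν + x' μ * |x ν - x' ν| := by
          rw [abs_mul, abs_mul, abs_of_nonneg (le_trans hγ.le hxν.1), abs_of_nonneg (le_trans hγ.le hxμ'.1)]
      _ ≤ δ * 1 + 1 * δ := by
          refine add_le_add ?_ ?_
          · exact mul_le_mul (hδ μ) hxν.2 (le_trans hγ.le hxν.1) hδ0
          · exact mul_le_mul hxμ'.2 (hδ ν) (abs_nonneg _) zero_le_one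
      _ = 2 * δ := by ring
  -- |D - D'| ≤ 3δ/γ²
  have hγinv : 1 / γ ≤ 1 / γ ^ 2 := by
    refine one_div_le_one_div_of_le hγ2 ?_
    calc γ ^ 2 = γ * γ := sq γ
      _ ≤ γ * 1 := mul_le_mul_of_nonneg_left hγ1 hγ.le
      _ = γ := mul_one γ
  have hDD : |D - D'| ≤ 3 / γ ^ 2 * δ := by
    have h1 : D - D' = (T - T') * (x μ * x ν) + T' * (x μ * x ν - x' μ * x' ν) := by
      rw [hD, hD']; ring
    rw [h1]
    have hprod1 : 0 ≤ x μ * x ν := mul_nonneg (le_trans hγ.le hxμ.1) (le_trans hγ.le hxν.1)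
    have hprod1' : x μ * x ν ≤ 1 := by
      calc x μ * x ν ≤ 1 * 1 := mul_le_mul hxμ.2 hxν.2 (le_trans hγ.le hxν.1) zero_le_one
        _ = 1 := one_mul 1
    calc |(T - T') * (x μ * x ν) + T' * (x μ * x ν - x' μ * x' ν)|
        ≤ |(T - T') * (x μ * x ν)| + |T' * (x μ * x ν - x' μ * x' ν)| := abs_add_le _ _
      _ = |T - T'| * (x μ * x ν) + T' * |x μ * x ν - x' μ * x' ν| := by
          rw [abs_mul (T - T') (x μ * x ν), abs_mul T' (x μ * x ν - x' μ * x' ν),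
            abs_of_nonneg hprod1, abs_of_pos hT'pos]
      _ ≤ (1 / γ ^ 2 * δ) * 1 + (1 / γ) * (2 * δ) := by
          refine add_le_add ?_ ?_
          · exact mul_le_mul hTT hprod1' hprod1 (by positivity)
          · exact mul_le_mul hTγ' hxx (abs_nonneg _) (by positivity)
      _ ≤ (1 / γ ^ 2 * δ) * 1 + (1 / γ ^ 2) * (2 * δ) := by
          have : (1 / γ) * (2 * δ) ≤ (1 / γ ^ 2) * (2 * δ) :=
            mul_le_mul_of_nonneg_right hγinv (by positivity)
          linarith
      _ = 3 / γ ^ 2 * δ := by ring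
  -- conclude
  have hsig : sig a x μ ν - sig a x' μ ν = 1 / D - 1 / D' := by
    unfold sig; rw [hD, hD']
  rw [hsig]
  calc |1 / D - 1 / D'| ≤ 1 / (γ ^ 2) ^ 2 * |D - D'| := abs_inv_sub_inv_le (γ ^ 2) hγ2 hDlo hDlo'
    _ ≤ 1 / (γ ^ 2) ^ 2 * (3 / γ ^ 2 * δ) := mul_le_mul_of_nonneg_left hDD (by positivity)
    _ = 3 / γ ^ 6 * δ := by
        have hγne : γ ≠ 0 := hγ.ne'
        field_simp

end Lipschitz

/-! ## §3. The rate of `Δ_k`'s multiplier (1.66) from the rate of the primitive `Δ₀φ_μ` -/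

section Rate

/-- `γ₀ = (4/π²)^{d+2}`, the tree's explicit lower constant of «0 < γ₀ ≤ Δ₀(p′)φ_μ(p′)»
(`B5Bounds167Lattice.Delta0_phi162_lower`). [folklore] -/
def gam0 (d : ℕ) : ℝ := (4 / Real.pi ^ 2) ^ (d + 2)

/-- `γ₀ > 0`. [folklore] -/
theorem gam0_pos (d : ℕ) : 0 < gam0 d := by unfold gam0; positivity

/-- `γ₀ ≤ 1` (`4 ≤ π²`). [folklore] -/
theorem gam0_le_one (d : ℕ) : gam0 d ≤ 1 := by
  unfold gam0
  have hπ : (4 : ℝ) / Real.pi ^ 2 ≤ 1 := by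
    rw [div_le_one (by positivity)]
    have h3 := Real.pi_gt_three
    nlinarith
  exact pow_le_one₀ (by positivity) hπ

/-- on the punctured Brillouin zone the inputs `x_λ = Δ₀φ^{(n)}_λ` lie in `[γ₀, 1]` for every `n ≥ 1`
(tree, BY NAME). [cite: Balaban1984PropagatorsI, p.28 after (1.62)] -/
theorem xIn_mem_box (n : ℕ) [NeZero n] (hn : 1 ≤ n) (s : Fin d → ℝ) (hs : ∀ κ, |s κ| ≤ Real.pi)
    (ν₀ : Fin d) (hν₀ : s ν₀ ≠ 0) (κ : Fin d) : gam0 d ≤ xIn n s κ ∧ xIn n s κ ≤ 1 :=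
  ⟨Delta0_phi162_lower n hn κ s hs ν₀ hν₀, Delta0_phi162_le_one n hn κ s hs⟩

/-- **The `η`-rate of the multiplier of `Δ_k` from the rate of `Δ₀φ`** (King (3.91) SHAPE for Bałaban's
(1.66)): for any two block sizes `n, n′ ≥ 1` and `p′ ≠ 0` in the Brillouin zone, if
`|Δ₀(p′)φ^{(n)}_λ(p′) − Δ₀(p′)φ^{(n′)}_λ(p′)| ≤ θ` for every `λ`, then
`|w166 n μ ν p′ − w166 n′ μ ν p′| ≤ 3γ₀⁻⁶·θ`.  The hypothesis `hφ` is NOT proved here (sibling leaf); given it,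
the statement is elementary Lipschitz algebra (§2).  The SHAPE is King's (3.91) p. 669; the statement for Bałaban's
`Δ_k` is printed nowhere. [folklore] -/
theorem w166_rate_of_phi162_rate (n n' : ℕ) [NeZero n] [NeZero n'] (hn : 1 ≤ n) (hn' : 1 ≤ n')
    (μ ν : Fin d) (s : Fin d → ℝ) (hs : ∀ κ, |s κ| ≤ Real.pi) (ν₀ : Fin d) (hν₀ : s ν₀ ≠ 0)
    {θ : ℝ} (hφ : ∀ κ, |Delta1r 0 s * phi162 n κ s - Delta1r 0 s * phi162 n' κ s| ≤ θ) :
    |w166 n μ ν s - w166 n' μ ν s| ≤ 3 / gam0 d ^ 6 * θ := by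
  rw [w166_eq_sig, w166_eq_sig]
  have hΔ : Delta1r 0 s ≠ 0 := (Delta1r_pos s hs ν₀ hν₀).ne'
  exact sig_lipschitz (aW s) (xIn n s) (xIn n' s) (gam0 d) θ (gam0_pos d) (gam0_le_one d)
    (aW_nonneg s) (sum_aW_eq_one s hΔ) (xIn_mem_box n hn s hs ν₀ hν₀) (xIn_mem_box n' hn' s hs ν₀ hν₀)
    (fun κ => hφ κ) μ ν

/-- **relative form** (literally King's (3.91) shape «≤ C·rate·|Δ^{(k)}(p)|»):
`|w166 n μ ν p′ − w166 n′ μ ν p′| ≤ 3γ₀⁻⁷·θ·w166 n μ ν p′` (since `w166 ≥ γ₀`). [folklore] -/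
theorem w166_rate_rel (n n' : ℕ) [NeZero n] [NeZero n'] (hn : 1 ≤ n) (hn' : 1 ≤ n')
    (μ ν : Fin d) (s : Fin d → ℝ) (hs : ∀ κ, |s κ| ≤ Real.pi) (ν₀ : Fin d) (hν₀ : s ν₀ ≠ 0)
    {θ : ℝ} (hφ : ∀ κ, |Delta1r 0 s * phi162 n κ s - Delta1r 0 s * phi162 n' κ s| ≤ θ) :
    |w166 n μ ν s - w166 n' μ ν s| ≤ 3 / gam0 d ^ 7 * θ * w166 n μ ν s := by
  have h := w166_rate_of_phi162_rate n n' hn hn' μ ν s hs ν₀ hν₀ hφ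
  have hθ : 0 ≤ θ := le_trans (abs_nonneg _) (hφ ν₀)
  have hw : gam0 d ≤ w166 n μ ν s := (w166_bounds n hn μ ν s hs ν₀ hν₀).1
  have hγ := gam0_pos d
  calc |w166 n μ ν s - w166 n' μ ν s| ≤ 3 / gam0 d ^ 6 * θ := h
    _ = 3 / gam0 d ^ 7 * θ * gam0 d := by
        field_simp
    _ ≤ 3 / gam0 d ^ 7 * θ * w166 n μ ν s := mul_le_mul_of_nonneg_left hw (by positivity)

/-- the two INVERSE `p′`-factors of `H_k` (1.63) and `G` (1.83)–(1.84) inherit the rate: `1/(Δ₀φ^{(n)}_μ)` and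
`(Σ_λ a_λ/(Δ₀φ^{(n)}_λ))⁻¹` move by at most `γ₀⁻²θ` under `hφ`. [folklore] -/
theorem inverse_factors_rate (n n' : ℕ) [NeZero n] [NeZero n'] (hn : 1 ≤ n) (hn' : 1 ≤ n')
    (μ : Fin d) (s : Fin d → ℝ) (hs : ∀ κ, |s κ| ≤ Real.pi) (ν₀ : Fin d) (hν₀ : s ν₀ ≠ 0)
    {θ : ℝ} (hφ : ∀ κ, |Delta1r 0 s * phi162 n κ s - Delta1r 0 s * phi162 n' κ s| ≤ θ) :
    |1 / xIn n s μ - 1 / xIn n' s μ| ≤ 1 / gam0 d ^ 2 * θ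
      ∧ |1 / (∑ κ, aW s κ / xIn n s κ) - 1 / (∑ κ, aW s κ / xIn n' s κ)| ≤ 1 / gam0 d ^ 2 * θ := by
  have hΔ : Delta1r 0 s ≠ 0 := (Delta1r_pos s hs ν₀ hν₀).ne'
  exact ⟨inv_lipschitz_on_box (xIn n s) (xIn n' s) (gam0 d) θ (gam0_pos d)
      (xIn_mem_box n hn s hs ν₀ hν₀) (xIn_mem_box n' hn' s hs ν₀ hν₀) (fun κ => hφ κ) μ,
    invMean_lipschitz (aW s) (xIn n s) (xIn n' s) (gam0 d) θ (gam0_pos d) (aW_nonneg s)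
      (sum_aW_eq_one s hΔ) (xIn_mem_box n hn s hs ν₀ hν₀) (xIn_mem_box n' hn' s hs ν₀ hν₀)
      (fun κ => hφ κ)⟩

end Rate

/-! ## §4. Form level on the unit torus: King's (3.92) shape for `⟨B, Δ_kB⟩` of (1.66) -/

section Form

variable (M : Fin d → ℕ) [hM : ∀ μ, NeZero (M μ)]

/-- **`|⟨B,Δ^{(n)}B⟩ − ⟨B,Δ^{(n′)}B⟩| ≤ 3γ₀⁻⁶θ·⟨∂₁B,∂₁B⟩`** on every unit torus `T₁ = Π_μ ℤ/M_μ`, for every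
vector field `B`, under the `Δ₀φ`-rate hypothesis at every nonzero coarse momentum ((3.92)-type: King bounds the
scalar form difference by `CL^{−2k}` times the a-priori field bounds (3.2), p. 669; here the size functional is
`⟨∂₁B,∂₁B⟩`; for Bałaban's `Δ_k` the statement is printed nowhere; elementary given `hφ`). [folklore] -/
theorem formDk_rate_of_phi162_rate (n n' : ℕ) [NeZero n] [NeZero n'] (hn : 1 ≤ n) (hn' : 1 ≤ n')
    (B : Tor M × Fin d → ℂ) {θ : ℝ} (hθ : 0 ≤ θ)
    (hφ : ∀ p : Tor M, sOf M p ≠ 0 → ∀ κ,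
      |Delta1r 0 (sOf M p) * phi162 n κ (sOf M p) - Delta1r 0 (sOf M p) * phi162 n' κ (sOf M p)| ≤ θ) :
    |formDk n M B - formDk n' M B| ≤ 3 / gam0 d ^ 6 * θ * d1Sq M B := by
  have hC : 0 ≤ 3 / gam0 d ^ 6 * θ := by have := gam0_pos d; positivity
  -- termwise bound at each coarse momentum
  have key : ∀ μ ν (p : Tor M),
      |w166 n μ ν (sOf M p) * ‖curlHat M B μ ν p‖ ^ 2 - w166 n' μ ν (sOf M p) * ‖curlHat M B μ ν p‖ ^ 2|
        ≤ 3 / gam0 d ^ 6 * θ * ‖curlHat M B μ ν p‖ ^ 2 := by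
    intro μ ν p
    rw [← sub_mul, abs_mul, abs_of_nonneg (by positivity : (0 : ℝ) ≤ ‖curlHat M B μ ν p‖ ^ 2)]
    by_cases hp : sOf M p = 0
    · rw [curlHat_eq_zero_of M B μ ν p hp, norm_zero]
      simp
    · obtain ⟨ν₀, hν₀⟩ := Function.ne_iff.mp hp
      exact mul_le_mul_of_nonneg_right
        (w166_rate_of_phi162_rate n n' hn hn' μ ν (sOf M p) (abs_sOf_le M p) ν₀ hν₀ (hφ p hp))
        (by positivity)
  rw [d1Sq_eq_sum_hat]
  unfold formDk
  rw [← mul_sub, ← Finset.sum_sub_distrib, abs_mul, abs_of_pos (by norm_num : (0 : ℝ) < 1 / 2)]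
  rw [show 3 / gam0 d ^ 6 * θ * (1 / 2 * ∑ μ, ∑ ν, ∑ p, ‖curlHat M B μ ν p‖ ^ 2)
      = 1 / 2 * (3 / gam0 d ^ 6 * θ * ∑ μ, ∑ ν, ∑ p, ‖curlHat M B μ ν p‖ ^ 2) by ring]
  refine mul_le_mul_of_nonneg_left ?_ (by norm_num)
  calc |∑ μ, (∑ ν, ∑ p, w166 n μ ν (sOf M p) * ‖curlHat M B μ ν p‖ ^ 2
          - ∑ ν, ∑ p, w166 n' μ ν (sOf M p) * ‖curlHat M B μ ν p‖ ^ 2)|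
      ≤ ∑ μ, |∑ ν, ∑ p, w166 n μ ν (sOf M p) * ‖curlHat M B μ ν p‖ ^ 2
          - ∑ ν, ∑ p, w166 n' μ ν (sOf M p) * ‖curlHat M B μ ν p‖ ^ 2| := Finset.abs_sum_le_sum_abs _ _
    _ ≤ ∑ μ, ∑ ν, ∑ p, 3 / gam0 d ^ 6 * θ * ‖curlHat M B μ ν p‖ ^ 2 := by
        refine Finset.sum_le_sum fun μ _ => ?_
        rw [← Finset.sum_sub_distrib]
        calc |∑ ν, (∑ p, w166 n μ ν (sOf M p) * ‖curlHat M B μ ν p‖ ^ 2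
                - ∑ p, w166 n' μ ν (sOf M p) * ‖curlHat M B μ ν p‖ ^ 2)|
            ≤ ∑ ν, |∑ p, w166 n μ ν (sOf M p) * ‖curlHat M B μ ν p‖ ^ 2
                - ∑ p, w166 n' μ ν (sOf M p) * ‖curlHat M B μ ν p‖ ^ 2| := Finset.abs_sum_le_sum_abs _ _
          _ ≤ ∑ ν, ∑ p, 3 / gam0 d ^ 6 * θ * ‖curlHat M B μ ν p‖ ^ 2 := by
              refine Finset.sum_le_sum fun ν _ => ?_
              rw [← Finset.sum_sub_distrib]
              calc |∑ p, (w166 n μ ν (sOf M p) * ‖curlHat M B μ ν p‖ ^ 2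
                      - w166 n' μ ν (sOf M p) * ‖curlHat M B μ ν p‖ ^ 2)|
                  ≤ ∑ p, |w166 n μ ν (sOf M p) * ‖curlHat M B μ ν p‖ ^ 2
                      - w166 n' μ ν (sOf M p) * ‖curlHat M B μ ν p‖ ^ 2| := Finset.abs_sum_le_sum_abs _ _
                _ ≤ ∑ p, 3 / gam0 d ^ 6 * θ * ‖curlHat M B μ ν p‖ ^ 2 :=
                    Finset.sum_le_sum fun p _ => key μ ν p
    _ = 3 / gam0 d ^ 6 * θ * ∑ μ, ∑ ν, ∑ p, ‖curlHat M B μ ν p‖ ^ 2 := by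
        rw [Finset.mul_sum]
        refine Finset.sum_congr rfl fun μ _ => ?_
        rw [Finset.mul_sum]
        refine Finset.sum_congr rfl fun ν _ => ?_
        rw [Finset.mul_sum]

/-- **relative form** ((3.91) shape at form level): `|⟨B,Δ^{(n)}B⟩ − ⟨B,Δ^{(n′)}B⟩| ≤ 3γ₀⁻⁷θ·⟨B,Δ^{(n)}B⟩`
(by (1.67): `γ₀⟨∂₁B,∂₁B⟩ ≤ ⟨B,Δ^{(n)}B⟩`, tree `ineq167`). [folklore] -/
theorem formDk_rate_rel (n n' : ℕ) [NeZero n] [NeZero n'] (hn : 1 ≤ n) (hn' : 1 ≤ n')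
    (B : Tor M × Fin d → ℂ) {θ : ℝ} (hθ : 0 ≤ θ)
    (hφ : ∀ p : Tor M, sOf M p ≠ 0 → ∀ κ,
      |Delta1r 0 (sOf M p) * phi162 n κ (sOf M p) - Delta1r 0 (sOf M p) * phi162 n' κ (sOf M p)| ≤ θ) :
    |formDk n M B - formDk n' M B| ≤ 3 / gam0 d ^ 7 * θ * formDk n M B := by
  have h := formDk_rate_of_phi162_rate M n n' hn hn' B hθ hφ
  have h167 : gam0 d * d1Sq M B ≤ formDk n M B := (ineq167 n M hn B).1
  have hγ := gam0_pos d
  calc |formDk n M B - formDk n' M B| ≤ 3 / gam0 d ^ 6 * θ * d1Sq M B := h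
    _ = 3 / gam0 d ^ 7 * θ * (gam0 d * d1Sq M B) := by
        field_simp
    _ ≤ 3 / gam0 d ^ 7 * θ * formDk n M B := mul_le_mul_of_nonneg_left h167 (by positivity)

/-- **King's printed shape, displayed**: if the primitive alias sums obey the `L^{−2k}` law
`|Δ₀φ^{(L^k)}_λ − Δ₀φ^{(L^{k+m})}_λ| ≤ C_φ·L^{−2k}` (the shape of King's Lemma 4.3 for the scalar sum; for
Bałaban's (1.62) it is the sibling seat's deliverable and is a HYPOTHESIS here), then
`|⟨B,(Δ_k − Δ_{k+m})B⟩| ≤ (3γ₀⁻⁷C_φ)·L^{−2k}·⟨B,Δ_kB⟩` — «|Δ^{(k)} − Δ^{(k+n)}| ≤ CL^{−2k}|Δ^{(k)}|» (3.91)/(3.92)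
for the `U = 1` gauge-field action — the printed SCALAR statement being [King1986, Prop. 3.10 (3.91)–(3.92) p. 669];
this vector-layer analogue is printed nowhere and is elementary given `hφ`. [folklore] -/
theorem formDk_rate_king_shape (L k m : ℕ) (hL : 2 ≤ L) (B : Tor M × Fin d → ℂ) {Cφ : ℝ} (hC : 0 ≤ Cφ)
    (hφ : ∀ p : Tor M, sOf M p ≠ 0 → ∀ κ,
      |Delta1r 0 (sOf M p) * phi162 (L ^ k) κ (sOf M p)
        - Delta1r 0 (sOf M p) * phi162 (L ^ (k + m)) κ (sOf M p)| ≤ Cφ * ((L : ℝ) ^ k)⁻¹ ^ 2) :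
    haveI : NeZero (L ^ k) := ⟨pow_ne_zero k (by omega)⟩
    haveI : NeZero (L ^ (k + m)) := ⟨pow_ne_zero (k + m) (by omega)⟩
    |formDk (L ^ k) M B - formDk (L ^ (k + m)) M B|
      ≤ 3 / gam0 d ^ 7 * Cφ * ((L : ℝ) ^ k)⁻¹ ^ 2 * formDk (L ^ k) M B := by
  haveI : NeZero (L ^ k) := ⟨pow_ne_zero k (by omega)⟩
  haveI : NeZero (L ^ (k + m)) := ⟨pow_ne_zero (k + m) (by omega)⟩
  have hLk : 1 ≤ L ^ k := Nat.one_le_pow k L (by omega)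
  have hLkm : 1 ≤ L ^ (k + m) := Nat.one_le_pow (k + m) L (by omega)
  have hθ : 0 ≤ Cφ * ((L : ℝ) ^ k)⁻¹ ^ 2 := by positivity
  have h := formDk_rate_rel M (L ^ k) (L ^ (k + m)) hLk hLkm B hθ hφ
  calc |formDk (L ^ k) M B - formDk (L ^ (k + m)) M B|
      ≤ 3 / gam0 d ^ 7 * (Cφ * ((L : ℝ) ^ k)⁻¹ ^ 2) * formDk (L ^ k) M B := h
    _ = 3 / gam0 d ^ 7 * Cφ * ((L : ℝ) ^ k)⁻¹ ^ 2 * formDk (L ^ k) M B := by ring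

end Form

/-! ## §5. Lemma 4.4 for the VECTOR averaging symbol of (1.61) -/

section Vector

open Literature.MathematicalPhysics.QuantumFieldTheory.King1986

/-- the symbol of the vector block averaging (1.61) in King's (4.3) vocabulary: `(uv_μ)^η(p) = u^η(p)·f_η(p_μ)`
with `u^η = uWeight η` (= `Π_ν f_η(p_ν)`, King (4.3) = the modulus-square root of B5 (1.31)) and one MORE factor
`f_η(p_μ) = uFac η (p μ)` for the bond direction `μ` (B5's `v_μ(p) = ∂¹_μ(p′)/∂_μ(p)` is its complex conjugate:
B5 writes `e^{+ip}`, King `e^{−ip}`).  [cite: Balaban1984PropagatorsI, (1.61) p.28] -/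
def qWeight (η : ℝ) (μ : Fin d) (p : Fin d → ℝ) : ℂ := uWeight η p * uFac η (p μ)

/-- `(uv_μ)^η(p)` as ONE product over `d + 1` factors (index `none ↦ μ`, `some ν ↦ ν`). [folklore] -/
theorem qWeight_eq_prod (η : ℝ) (μ : Fin d) (p : Fin d → ℝ) :
    qWeight η μ p = ∏ o : Option (Fin d), uFac η (p (o.elim μ id)) := by
  rw [Fintype.prod_option]
  unfold qWeight uWeight
  simp [mul_comm]

/-- **Lemma 4.4 for the vector symbol (1.61)**, `γ = 1` form with explicit constant: for two spacings
`0 < η, η′` and `p` in the common zone (`|ηp_ν| ≤ π`, `|η′p_ν| ≤ π`),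
`‖(uv_μ)^η(p) − (uv_μ)^{η′}(p)‖ ≤ (π/2)^{d+1}·((Σ_ν (π/2)|η−η′||p_ν|) + (π/2)|η−η′||p_μ|)·‖(uv_μ)^η(p)‖` —
King's «replace factor by factor» with `d + 1` factors. [cite: King1986, Lemma 4.4 (4.29)–(4.30) p.673] -/
theorem lemma44_vector {η η' : ℝ} (hη : 0 < η) (hη' : 0 < η') {p : Fin d → ℝ}
    (hp : ∀ ν, |η * p ν| ≤ Real.pi) (hp' : ∀ ν, |η' * p ν| ≤ Real.pi) (μ : Fin d) :
    ‖qWeight η μ p - qWeight η' μ p‖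
      ≤ (Real.pi / 2) ^ (d + 1)
          * ((∑ ν, Real.pi / 2 * |η - η'| * |p ν|) + Real.pi / 2 * |η - η'| * |p μ|)
          * ‖qWeight η μ p‖ := by
  rw [qWeight_eq_prod, qWeight_eq_prod, norm_prod]
  have hK : (1 : ℝ) ≤ Real.pi / 2 := by linarith [Real.pi_gt_three]
  have hzone : ∀ o : Option (Fin d), |η * p (o.elim μ id)| ≤ Real.pi := fun o => hp _
  have hzone' : ∀ o : Option (Fin d), |η' * p (o.elim μ id)| ≤ Real.pi := fun o => hp' _
  have h := norm_prod_sub_prod_le_rel (Finset.univ : Finset (Option (Fin d)))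
    (fun o => uFac η (p (o.elim μ id))) (fun o => uFac η' (p (o.elim μ id)))
    (fun o => Real.pi / 2 * |η - η'| * |p (o.elim μ id)|) hK
    (fun o _ => by positivity)
    (fun o _ => norm_uFac_sub_uFac_le hη hη' (hzone o) (hzone' o))
    (fun o _ => norm_uFac_le_mul hη hη' (hzone o) (hzone' o))
  have hcard : (Finset.univ : Finset (Option (Fin d))).card = d + 1 := by
    rw [Finset.card_univ, Fintype.card_option, Fintype.card_fin]
  rw [hcard] at h
  have hsum : ∑ o : Option (Fin d), Real.pi / 2 * |η - η'| * |p (o.elim μ id)|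
      = (∑ ν, Real.pi / 2 * |η - η'| * |p ν|) + Real.pi / 2 * |η - η'| * |p μ| := by
    rw [Fintype.sum_option]
    simp [add_comm]
  rw [hsum] at h
  exact h

/-- **(4.29) for the vector symbol in King's scaling** `η = L^{−k}`, `η′ = L^{−(k+n)}`: on the zone
`|p_ν| ≤ πL^k`, `‖(uv_μ)_k − (uv_μ)_{k+n}‖ ≤ (π/2)^{d+2}·L^{−k}·(Σ_ν|p_ν| + |p_μ|)·‖(uv_μ)_k‖`.
[cite: King1986, Lemma 4.4 (4.29) p.673] -/
theorem lemma44_vector_scaling {L k n : ℕ} (hL : 2 ≤ L) {p : Fin d → ℝ}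
    (hp : ∀ ν, |p ν| ≤ Real.pi * (L : ℝ) ^ k) (μ : Fin d) :
    ‖qWeight (((L : ℝ) ^ k)⁻¹) μ p - qWeight (((L : ℝ) ^ (k + n))⁻¹) μ p‖
      ≤ (Real.pi / 2) ^ (d + 2) * ((L : ℝ) ^ k)⁻¹ * ((∑ ν, |p ν|) + |p μ|)
          * ‖qWeight (((L : ℝ) ^ k)⁻¹) μ p‖ := by
  have hL1 : (1 : ℝ) < L := by exact_mod_cast hL
  have hLk : 0 < (L : ℝ) ^ k := pow_pos (by linarith) k
  have hLkn : 0 < (L : ℝ) ^ (k + n) := pow_pos (by linarith) (k + n)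
  have hη : 0 < ((L : ℝ) ^ k)⁻¹ := inv_pos.mpr hLk
  have hη' : 0 < ((L : ℝ) ^ (k + n))⁻¹ := inv_pos.mpr hLkn
  have hle : ((L : ℝ) ^ (k + n))⁻¹ ≤ ((L : ℝ) ^ k)⁻¹ := by
    apply inv_anti₀ hLk
    rw [pow_add]
    exact le_mul_of_one_le_right hLk.le (one_le_pow₀ hL1.le)
  have hzone : ∀ ν, |((L : ℝ) ^ k)⁻¹ * p ν| ≤ Real.pi := by
    intro ν
    rw [abs_mul, abs_of_pos hη, inv_mul_le_iff₀ hLk]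
    calc |p ν| ≤ Real.pi * (L : ℝ) ^ k := hp ν
      _ = (L : ℝ) ^ k * Real.pi := mul_comm _ _
  have hzone' : ∀ ν, |((L : ℝ) ^ (k + n))⁻¹ * p ν| ≤ Real.pi := by
    intro ν
    rw [abs_mul, abs_of_pos hη']
    calc ((L : ℝ) ^ (k + n))⁻¹ * |p ν| ≤ ((L : ℝ) ^ k)⁻¹ * |p ν| :=
          mul_le_mul_of_nonneg_right hle (abs_nonneg _)
      _ = |((L : ℝ) ^ k)⁻¹ * p ν| := by rw [abs_mul, abs_of_pos hη]
      _ ≤ Real.pi := hzone ν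
  have h := lemma44_vector hη hη' hzone hzone' μ
  have hdiff : |((L : ℝ) ^ k)⁻¹ - ((L : ℝ) ^ (k + n))⁻¹| ≤ ((L : ℝ) ^ k)⁻¹ := by
    rw [abs_of_nonneg (by linarith)]
    linarith [hη'.le]
  have hπ := Real.pi_pos
  have hsum : (∑ ν, Real.pi / 2 * |((L : ℝ) ^ k)⁻¹ - ((L : ℝ) ^ (k + n))⁻¹| * |p ν|)
        + Real.pi / 2 * |((L : ℝ) ^ k)⁻¹ - ((L : ℝ) ^ (k + n))⁻¹| * |p μ|
      ≤ Real.pi / 2 * ((L : ℝ) ^ k)⁻¹ * ((∑ ν, |p ν|) + |p μ|) := by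
    rw [mul_add, Finset.mul_sum]
    refine add_le_add (Finset.sum_le_sum fun ν _ => ?_) ?_
    · have := abs_nonneg (p ν)
      gcongr
    · have := abs_nonneg (p μ)
      gcongr
  have hU := norm_nonneg (qWeight (((L : ℝ) ^ k)⁻¹) μ p)
  have hπ2 : 0 ≤ (Real.pi / 2) ^ (d + 1) := by positivity
  calc ‖qWeight (((L : ℝ) ^ k)⁻¹) μ p - qWeight (((L : ℝ) ^ (k + n))⁻¹) μ p‖
      ≤ (Real.pi / 2) ^ (d + 1)
          * ((∑ ν, Real.pi / 2 * |((L : ℝ) ^ k)⁻¹ - ((L : ℝ) ^ (k + n))⁻¹| * |p ν|)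
              + Real.pi / 2 * |((L : ℝ) ^ k)⁻¹ - ((L : ℝ) ^ (k + n))⁻¹| * |p μ|)
          * ‖qWeight (((L : ℝ) ^ k)⁻¹) μ p‖ := h
    _ ≤ (Real.pi / 2) ^ (d + 1) * (Real.pi / 2 * ((L : ℝ) ^ k)⁻¹ * ((∑ ν, |p ν|) + |p μ|))
          * ‖qWeight (((L : ℝ) ^ k)⁻¹) μ p‖ :=
        mul_le_mul_of_nonneg_right (mul_le_mul_of_nonneg_left hsum hπ2) hU
    _ = (Real.pi / 2) ^ (d + 2) * ((L : ℝ) ^ k)⁻¹ * ((∑ ν, |p ν|) + |p μ|)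
          * ‖qWeight (((L : ℝ) ^ k)⁻¹) μ p‖ := by rw [pow_succ]; ring

end Vector

/-! ## §6. (v1.1) Corollaries GIVEN `hφ`: the sibling's interface variant, the per-mode log-rate (the ingredient
of King's normalisation estimate (3.93) p. 669), and the `η → 0` LIMIT of `Δ_k`'s multiplier and of the form
`⟨B, Δ_kB⟩` at rate `L^{-2k}` -/

section Limit

open Filter Topology

/-- interface variant: a bound `|φ^{(n)}_λ − φ^{(n′)}_λ| ≤ θ′` on the primitive WITHOUT the `Δ₀` factor (the shape
the sibling seat announced) gives `hφ` with `θ = 4d·θ′`, since `0 ≤ Δ₀ ≤ 4d` (tree `Delta1r_nonneg`, `Delta1r_le`).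
[folklore] -/
theorem hphi_of_phi162_rate (n n' : ℕ) (s : Fin d → ℝ) {θ' : ℝ}
    (h : ∀ κ, |phi162 n κ s - phi162 n' κ s| ≤ θ') (κ : Fin d) :
    |Delta1r 0 s * phi162 n κ s - Delta1r 0 s * phi162 n' κ s| ≤ 4 * d * θ' := by
  rw [← mul_sub, abs_mul, abs_of_nonneg (Delta1r_nonneg 0 le_rfl s)]
  have hθ' : 0 ≤ θ' := le_trans (abs_nonneg _) (h κ)
  exact mul_le_mul (Delta1r_le s) (h κ) (abs_nonneg _) (by positivity)

/-- [folklore] `|log a − log b| ≤ |a − b|/γ` for `a, b ≥ γ > 0` (from `log x ≤ x − 1`). -/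
theorem abs_log_sub_log_le_div {γ a b : ℝ} (hγ : 0 < γ) (ha : γ ≤ a) (hb : γ ≤ b) :
    |Real.log a - Real.log b| ≤ |a - b| / γ := by
  have ha0 : 0 < a := lt_of_lt_of_le hγ ha
  have hb0 : 0 < b := lt_of_lt_of_le hγ hb
  have one : ∀ {x y : ℝ}, 0 < x → γ ≤ y → Real.log x - Real.log y ≤ |x - y| / γ := by
    intro x y hx hy
    have hy0 : 0 < y := lt_of_lt_of_le hγ hy
    have h1 : Real.log x - Real.log y = Real.log (x / y) := by rw [Real.log_div hx.ne' hy0.ne']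
    have h2 : Real.log (x / y) ≤ x / y - 1 := Real.log_le_sub_one_of_pos (div_pos hx hy0)
    have h3 : x / y - 1 = (x - y) / y := by field_simp
    have h4 : (x - y) / y ≤ |x - y| / y := div_le_div_of_nonneg_right (le_abs_self _) hy0.le
    have h5 : |x - y| / y ≤ |x - y| / γ := div_le_div_of_nonneg_left (abs_nonneg _) hγ hy
    linarith
  rw [abs_sub_le_iff]
  refine ⟨one ha0 hb, ?_⟩
  have := one hb0 ha
  rwa [abs_sub_comm] at this

/-- per-mode LOG-rate (King's (3.93) ingredient «ln[1 + (Δ^{(k+n)}(p) − Δ^{(k)}(p))Δ^{(k)}(p)⁻¹] ≤ CL^{−2k}»,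
p. 669, for Bałaban's (1.66) weight): under `hφ`, `|log w166 n μ ν p′ − log w166 n′ μ ν p′| ≤ 3γ₀⁻⁷θ`
(both weights are `≥ γ₀`). [folklore] -/
theorem log_w166_rate (n n' : ℕ) [NeZero n] [NeZero n'] (hn : 1 ≤ n) (hn' : 1 ≤ n')
    (μ ν : Fin d) (s : Fin d → ℝ) (hs : ∀ κ, |s κ| ≤ Real.pi) (ν₀ : Fin d) (hν₀ : s ν₀ ≠ 0)
    {θ : ℝ} (hφ : ∀ κ, |Delta1r 0 s * phi162 n κ s - Delta1r 0 s * phi162 n' κ s| ≤ θ) :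
    |Real.log (w166 n μ ν s) - Real.log (w166 n' μ ν s)| ≤ 3 / gam0 d ^ 7 * θ := by
  have h := w166_rate_of_phi162_rate n n' hn hn' μ ν s hs ν₀ hν₀ hφ
  have hw : gam0 d ≤ w166 n μ ν s := (w166_bounds n hn μ ν s hs ν₀ hν₀).1
  have hw' : gam0 d ≤ w166 n' μ ν s := (w166_bounds n' hn' μ ν s hs ν₀ hν₀).1
  have hγ := gam0_pos d
  calc |Real.log (w166 n μ ν s) - Real.log (w166 n' μ ν s)|
      ≤ |w166 n μ ν s - w166 n' μ ν s| / gam0 d := abs_log_sub_log_le_div hγ hw hw'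
    _ ≤ (3 / gam0 d ^ 6 * θ) / gam0 d := div_le_div_of_nonneg_right h hγ.le
    _ = 3 / gam0 d ^ 7 * θ := by
        field_simp

/-- [folklore] a real sequence with UNIFORMLY small tails, `|x k − x (k+m)| ≤ C·r^k` for all `k, m` (`0 ≤ r < 1`),
converges, and its limit obeys the same bound `|x k − x_∞| ≤ C·r^k` (King's use of the `n`-uniformity of
Prop. 3.10 / Lemma 4.3). -/
theorem exists_limit_of_uniform_tail {x : ℕ → ℝ} {C r : ℝ} (hr0 : 0 ≤ r) (hr1 : r < 1)
    (h : ∀ k m, |x k - x (k + m)| ≤ C * r ^ k) :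
    ∃ xinf : ℝ, Tendsto x atTop (𝓝 xinf) ∧ ∀ k, |x k - xinf| ≤ C * r ^ k := by
  have hcau : CauchySeq x := by
    refine Metric.cauchySeq_iff'.2 fun ε hε => ?_
    have ht : Tendsto (fun k => C * r ^ k) atTop (𝓝 (C * 0)) :=
      (tendsto_pow_atTop_nhds_zero_of_lt_one hr0 hr1).const_mul C
    rw [mul_zero] at ht
    obtain ⟨N, hN⟩ := ((tendsto_order.1 ht).2 ε hε).exists
    refine ⟨N, fun n hn => ?_⟩
    obtain ⟨m, rfl⟩ := Nat.exists_eq_add_of_le hn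
    rw [dist_comm, Real.dist_eq]
    exact lt_of_le_of_lt (h N m) hN
  obtain ⟨xinf, hx⟩ := cauchySeq_tendsto_of_complete hcau
  refine ⟨xinf, hx, fun k => ?_⟩
  have h1 : Tendsto (fun m => x (k + m)) atTop (𝓝 xinf) := by
    have := hx.comp (tendsto_add_atTop_nat k)
    refine this.congr' (Eventually.of_forall fun m => ?_)
    simp [Function.comp, add_comm]
  have ht : Tendsto (fun m => |x k - x (k + m)|) atTop (𝓝 |x k - xinf|) :=
    (tendsto_const_nhds.sub h1).abs
  exact le_of_tendsto' ht fun m => h k m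

/-- `(L^k)⁻² = (L⁻²)^k` bookkeeping. [folklore] -/
theorem inv_pow_sq_eq (L : ℝ) (k : ℕ) : (L ^ k)⁻¹ ^ 2 = ((L ^ 2)⁻¹) ^ k := by
  rw [inv_pow, inv_pow, ← pow_mul, ← pow_mul, mul_comm]

/-- **`Δ_k`'s multiplier HAS an `η → 0` limit, at rate `L^{-2k}`, GIVEN `hφ` in King's Lemma 4.3 shape**: if
`|Δ₀φ^{(L^k)}_λ(p′) − Δ₀φ^{(L^{k+m})}_λ(p′)| ≤ C_φ·L^{-2k}` for all `k, m, λ` at a fixed `p′ ≠ 0` (`2 ≤ L`), then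
`w_∞(p′) := lim_k w166 (L^k) μ ν p′` exists, `|w166 (L^k) μ ν p′ − w_∞(p′)| ≤ 3γ₀⁻⁶C_φ·L^{-2k}` for EVERY `k`, and
`w_∞(p′) ≥ γ₀` — the unit-scale continuum limit of the `U = 1` effective gauge-field action's multiplier, with
its rate (the statement King's (3.91) is used for, p. 669; printed nowhere for Bałaban's `Δ_k`; `hφ` NOT proved
here). [folklore] -/
theorem w166_limit (L : ℕ) (hL : 2 ≤ L) (μ ν : Fin d) (s : Fin d → ℝ) (hs : ∀ κ, |s κ| ≤ Real.pi)
    (ν₀ : Fin d) (hν₀ : s ν₀ ≠ 0) {Cφ : ℝ}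
    (hφ : ∀ k m : ℕ, ∀ κ, |Delta1r 0 s * phi162 (L ^ k) κ s - Delta1r 0 s * phi162 (L ^ (k + m)) κ s|
        ≤ Cφ * ((L : ℝ) ^ k)⁻¹ ^ 2) :
    ∃ winf : ℝ, Tendsto (fun k => w166 (L ^ k) μ ν s) atTop (𝓝 winf)
      ∧ (∀ k, |w166 (L ^ k) μ ν s - winf| ≤ 3 / gam0 d ^ 6 * Cφ * ((L : ℝ) ^ k)⁻¹ ^ 2)
      ∧ gam0 d ≤ winf := by
  have hrate : ∀ k m, |w166 (L ^ k) μ ν s - w166 (L ^ (k + m)) μ ν s|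
      ≤ (3 / gam0 d ^ 6 * Cφ) * (((L : ℝ) ^ 2)⁻¹) ^ k := by
    intro k m
    haveI : NeZero (L ^ k) := ⟨pow_ne_zero k (by omega)⟩
    haveI : NeZero (L ^ (k + m)) := ⟨pow_ne_zero (k + m) (by omega)⟩
    have h := w166_rate_of_phi162_rate (L ^ k) (L ^ (k + m)) (Nat.one_le_pow k L (by omega))
      (Nat.one_le_pow (k + m) L (by omega)) μ ν s hs ν₀ hν₀ (hφ k m)
    calc |w166 (L ^ k) μ ν s - w166 (L ^ (k + m)) μ ν s| ≤ 3 / gam0 d ^ 6 * (Cφ * ((L : ℝ) ^ k)⁻¹ ^ 2) := h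
      _ = (3 / gam0 d ^ 6 * Cφ) * (((L : ℝ) ^ 2)⁻¹) ^ k := by rw [inv_pow_sq_eq]; ring
  have hL' : (2 : ℝ) ≤ L := by exact_mod_cast hL
  have hr0 : 0 ≤ ((L : ℝ) ^ 2)⁻¹ := by positivity
  have hr1 : ((L : ℝ) ^ 2)⁻¹ < 1 := by
    apply inv_lt_one_of_one_lt₀
    nlinarith
  obtain ⟨winf, ht, hb⟩ := exists_limit_of_uniform_tail hr0 hr1 hrate
  refine ⟨winf, ht, fun k => ?_, ?_⟩
  · calc |w166 (L ^ k) μ ν s - winf| ≤ (3 / gam0 d ^ 6 * Cφ) * (((L : ℝ) ^ 2)⁻¹) ^ k := hb k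
      _ = 3 / gam0 d ^ 6 * Cφ * ((L : ℝ) ^ k)⁻¹ ^ 2 := by rw [inv_pow_sq_eq]
  · refine ge_of_tendsto' ht fun k => ?_
    haveI : NeZero (L ^ k) := ⟨pow_ne_zero k (by omega)⟩
    exact (w166_bounds (L ^ k) (Nat.one_le_pow k L (by omega)) μ ν s hs ν₀ hν₀).1

variable (M : Fin d → ℕ) [hM : ∀ μ, NeZero (M μ)]

/-- **the form `⟨B, Δ_kB⟩` of the `U = 1` effective gauge-field action CONVERGES as `k → ∞`, at rate `L^{-2k}`,
for every vector field `B` on every unit torus, GIVEN `hφ`** (in King's Lemma 4.3 shape at every nonzero coarse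
momentum): `|⟨B, Δ_kB⟩ − F_∞(B)| ≤ 3γ₀⁻⁶C_φL^{-2k}·⟨∂₁B, ∂₁B⟩`.  (King's (3.92) is the corresponding step for the
scalar `Δ^{(k)}`, p. 669; printed nowhere for Bałaban's `Δ_k`; `hφ` NOT proved here.) [folklore] -/
theorem formDk_limit (L : ℕ) (hL : 2 ≤ L) (B : Tor M × Fin d → ℂ) {Cφ : ℝ} (hC : 0 ≤ Cφ)
    (hφ : ∀ k m : ℕ, ∀ p : Tor M, sOf M p ≠ 0 → ∀ κ,
      |Delta1r 0 (sOf M p) * phi162 (L ^ k) κ (sOf M p)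
        - Delta1r 0 (sOf M p) * phi162 (L ^ (k + m)) κ (sOf M p)| ≤ Cφ * ((L : ℝ) ^ k)⁻¹ ^ 2) :
    ∃ Finf : ℝ, Tendsto (fun k => formDk (L ^ k) M B) atTop (𝓝 Finf)
      ∧ ∀ k, |formDk (L ^ k) M B - Finf| ≤ 3 / gam0 d ^ 6 * Cφ * ((L : ℝ) ^ k)⁻¹ ^ 2 * d1Sq M B := by
  have hrate : ∀ k m, |formDk (L ^ k) M B - formDk (L ^ (k + m)) M B|
      ≤ (3 / gam0 d ^ 6 * Cφ * d1Sq M B) * (((L : ℝ) ^ 2)⁻¹) ^ k := by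
    intro k m
    haveI : NeZero (L ^ k) := ⟨pow_ne_zero k (by omega)⟩
    haveI : NeZero (L ^ (k + m)) := ⟨pow_ne_zero (k + m) (by omega)⟩
    have hθ : 0 ≤ Cφ * ((L : ℝ) ^ k)⁻¹ ^ 2 := by positivity
    have h := formDk_rate_of_phi162_rate M (L ^ k) (L ^ (k + m)) (Nat.one_le_pow k L (by omega))
      (Nat.one_le_pow (k + m) L (by omega)) B hθ (hφ k m)
    calc |formDk (L ^ k) M B - formDk (L ^ (k + m)) M B|
        ≤ 3 / gam0 d ^ 6 * (Cφ * ((L : ℝ) ^ k)⁻¹ ^ 2) * d1Sq M B := h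
      _ = (3 / gam0 d ^ 6 * Cφ * d1Sq M B) * (((L : ℝ) ^ 2)⁻¹) ^ k := by rw [inv_pow_sq_eq]; ring
  have hL' : (2 : ℝ) ≤ L := by exact_mod_cast hL
  have hr0 : 0 ≤ ((L : ℝ) ^ 2)⁻¹ := by positivity
  have hr1 : ((L : ℝ) ^ 2)⁻¹ < 1 := by
    apply inv_lt_one_of_one_lt₀
    nlinarith
  obtain ⟨Finf, ht, hb⟩ := exists_limit_of_uniform_tail hr0 hr1 hrate
  refine ⟨Finf, ht, fun k => ?_⟩
  calc |formDk (L ^ k) M B - Finf| ≤ (3 / gam0 d ^ 6 * Cφ * d1Sq M B) * (((L : ℝ) ^ 2)⁻¹) ^ k := hb k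
    _ = 3 / gam0 d ^ 6 * Cφ * ((L : ℝ) ^ k)⁻¹ ^ 2 * d1Sq M B := by rw [inv_pow_sq_eq]; ring

end Limit

/-! ## §7. (v1.2) The SECOND PRIMITIVE alias sum of (1.63), `ψ₂(p′) = Σ_{l″}|u(p′+l″)|²Δ₀²(p′)/Δ²(p′+l″)`:
its two-sided bounds `γ₀ ≤ ψ₂ ≤ 1` on the punctured Brillouin zone (kernel, from the tree's E3/E4 leaves), and
the rate of the inverse factor `ψ₂⁻¹` of (1.63) GIVEN a rate hypothesis `hψ` on `ψ₂` (cell GAPS G-ne2p2-2: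
the rate of `ψ₂` itself is, like `hφ`, the sibling lane's alias-sum deliverable and is NOT proved here). -/

section Psi

/-- (1.63)'s second primitive alias sum «(Σ_{l″}|u(p′+l″)|²Δ₀²(p′)/Δ²(p′+l″))⁻¹» (the normalising sum in
the second term of B5's momentum representation of `H_kB`), WITHOUT the inverse, at `p′ = s`, `l″ = 2πk`,
`k : Fin d → Fin n`, with the typed `u` of (1.61) (`uSym`) and `Δ(p′+l″) = DeltaXir n 0 (shiftr n k s)`.
[cite: Balaban1984PropagatorsI, (1.63) p.28] -/
def psi163 (n : ℕ) (s : Fin d → ℝ) : ℝ :=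
  ∑ k : Fin d → Fin n, ‖uSym n k s‖ ^ 2 * Delta1r 0 s ^ 2 / DeltaXir n 0 (shiftr n k s) ^ 2

/-- `ψ₂ ≥ 0`. [folklore] -/
theorem psi163_nonneg (n : ℕ) (s : Fin d → ℝ) : 0 ≤ psi163 n s :=
  Finset.sum_nonneg fun _ _ => div_nonneg (mul_nonneg (sq_nonneg _) (sq_nonneg _)) (sq_nonneg _)

/-- UPPER bound `ψ₂(p′) ≤ Σ_{l″}|u(p′+l″)|² = 1` on the Brillouin zone, for every `n ≥ 1` — by `Δ₀(p′) ≤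
Δ(p′+l″)` (tree `Delta1r_le_DeltaXir_shift`) and E4 `Σ_l|u(p′+l)|² = 1` (tree `sum_Ur_eq_one`). [folklore] -/
theorem psi163_le_one (n : ℕ) [NeZero n] (hn : 1 ≤ n) (s : Fin d → ℝ) (hs : ∀ ν, |s ν| ≤ Real.pi) :
    psi163 n s ≤ 1 := by
  unfold psi163
  rw [← sum_Ur_eq_one n hn s hs]
  refine Finset.sum_le_sum fun k _ => ?_
  rw [norm_uSym_sq n hn k s hs]
  have hU0 := Ur_nonneg n k s
  have hΔ0 : 0 ≤ Delta1r 0 s := Delta1r_nonneg 0 le_rfl s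
  have hle := Delta1r_le_DeltaXir_shift n hn k s
  rcases (DeltaXir_nonneg n 0 le_rfl (shiftr n k s)).eq_or_lt with h0 | hpos
  · rw [← h0]
    simpa using hU0
  · rw [div_le_iff₀ (pow_pos hpos 2)]
    have h2 : Delta1r 0 s ^ 2 ≤ DeltaXir n 0 (shiftr n k s) ^ 2 := pow_le_pow_left₀ hΔ0 hle 2
    exact mul_le_mul_of_nonneg_left h2 hU0

/-- LOWER bound `ψ₂(p′) ≥ γ₀ = (4/π²)^{d+2}` on the punctured Brillouin zone, for every `n ≥ 1` — keep the
`l″ = 0` term: `|u(p′)|² ≥ (4/π²)^d` (tree `Ur_zero_ge`), `(Δ₀(p′)/Δ(p′))² ≥ (4/π²)²` (tree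
`DeltaXir_le_Delta1r`, Jordan). [folklore] -/
theorem psi163_lower (n : ℕ) [NeZero n] (hn : 1 ≤ n) (s : Fin d → ℝ) (hs : ∀ ν, |s ν| ≤ Real.pi)
    (ν₀ : Fin d) (hν₀ : s ν₀ ≠ 0) : gam0 d ≤ psi163 n s := by
  have hD : 0 < DeltaXir n 0 s := DeltaXir_pos n hn s hs ν₀ hν₀
  have hpi := Real.pi_pos
  have h1 : (4 / Real.pi ^ 2) ^ d ≤ Ur n (fun _ => (0 : Fin n)) s := Ur_zero_ge n hn s hs
  have h3 : 4 / Real.pi ^ 2 ≤ Delta1r 0 s / DeltaXir n 0 s := by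
    rw [le_div_iff₀ hD]
    have h4 := DeltaXir_le_Delta1r n s hs
    calc 4 / Real.pi ^ 2 * DeltaXir n 0 s ≤ 4 / Real.pi ^ 2 * (Real.pi ^ 2 / 4 * Delta1r 0 s) :=
          mul_le_mul_of_nonneg_left h4 (by positivity)
      _ = Delta1r 0 s := by field_simp
  have h33 : (4 / Real.pi ^ 2) ^ 2 ≤ (Delta1r 0 s / DeltaXir n 0 s) ^ 2 :=
    pow_le_pow_left₀ (by positivity) h3 2
  unfold psi163
  set f : (Fin d → Fin n) → ℝ :=
    fun k => ‖uSym n k s‖ ^ 2 * Delta1r 0 s ^ 2 / DeltaXir n 0 (shiftr n k s) ^ 2 with hf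
  have hsum : f (fun _ => 0) ≤ ∑ k, f k :=
    Finset.single_le_sum (fun k _ => div_nonneg (mul_nonneg (sq_nonneg _) (sq_nonneg _)) (sq_nonneg _))
      (Finset.mem_univ _)
  have hf0 : f (fun _ => 0) = Ur n (fun _ => (0 : Fin n)) s * (Delta1r 0 s / DeltaXir n 0 s) ^ 2 := by
    rw [hf]
    simp only [shiftr_zero]
    rw [norm_uSym_sq n hn _ s hs, div_pow]
    ring
  calc gam0 d = (4 / Real.pi ^ 2) ^ d * (4 / Real.pi ^ 2) ^ 2 := by unfold gam0; ring
    _ ≤ Ur n (fun _ => (0 : Fin n)) s * (Delta1r 0 s / DeltaXir n 0 s) ^ 2 :=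
        mul_le_mul h1 h33 (by positivity) (Ur_nonneg _ _ _)
    _ = f (fun _ => 0) := hf0.symm
    _ ≤ ∑ k, f k := hsum

/-- `ψ₂^{(n)}(p′) ∈ [γ₀, 1]` on the punctured Brillouin zone — the two-sided box the inverse needs. [folklore] -/
theorem psi163_mem_box (n : ℕ) [NeZero n] (hn : 1 ≤ n) (s : Fin d → ℝ) (hs : ∀ ν, |s ν| ≤ Real.pi)
    (ν₀ : Fin d) (hν₀ : s ν₀ ≠ 0) : gam0 d ≤ psi163 n s ∧ psi163 n s ≤ 1 :=
  ⟨psi163_lower n hn s hs ν₀ hν₀, psi163_le_one n hn s hs⟩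

/-- the inverse factor `ψ₂(p′)⁻¹` of (1.63) GIVEN a rate `hψ : |ψ₂^{(n)}(p′) − ψ₂^{(n′)}(p′)| ≤ θ_ψ` of the
second primitive (NOT proved here — cell GAPS G-ne2p2-2): `|ψ₂^{(n)}(p′)⁻¹ − ψ₂^{(n′)}(p′)⁻¹| ≤ γ₀⁻²θ_ψ`
(both `ψ₂ ≥ γ₀`).  With `inverse_factors_rate` (§3) this covers EVERY inverse `p′`-factor of (1.63).
[folklore] -/
theorem inv_psi163_rate (n n' : ℕ) [NeZero n] [NeZero n'] (hn : 1 ≤ n) (hn' : 1 ≤ n')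
    (s : Fin d → ℝ) (hs : ∀ ν, |s ν| ≤ Real.pi) (ν₀ : Fin d) (hν₀ : s ν₀ ≠ 0)
    {θ : ℝ} (hψ : |psi163 n s - psi163 n' s| ≤ θ) :
    |1 / psi163 n s - 1 / psi163 n' s| ≤ 1 / gam0 d ^ 2 * θ := by
  have h := abs_inv_sub_inv_le (gam0 d) (gam0_pos d) (psi163_lower n hn s hs ν₀ hν₀)
    (psi163_lower n' hn' s hs ν₀ hν₀)
  exact h.trans (mul_le_mul_of_nonneg_left hψ (by positivity))

end Psi

end Literature.MathematicalPhysics.QuantumFieldTheory.Balaban1983to89.T4GaugeActionRate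

end
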